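import Summits.MatrixMultiplication.MatrixMultiplication.Theorems.SubgroupIdentityDesigns.Negative.VolumeRatioLaw
import Summits.MatrixMultiplication.MatrixMultiplication.Theorems.SubgroupIdentityDesigns.Negative.FamilyAOptimum
import Summits.MatrixMultiplication.MatrixMultiplication.Theorems.SubgroupIdentityDesigns.Negative.LevelOneDim

/-!
# The volume ratio `2` is attained in the limit: Family A has `V / dim F_1 → 2⁻`
(negative-side lemma for the crux `SubgroupIdentityDesigns`, stmt-MatrixMultiplication-14079; VALUE = a theorem about the
design-volume statistic, NOT summit progress; the crux item stays open)

`VolumeRatioLaw.lean` prices the census conjecture (V2) "`|H₁||H₂||H₃| ≤ 2 · dim F_k|_{GL_m(𝔽_p)}` for every subgroup-TPP triple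
carrying a level-`k` identity design".  This file shows that the constant `2` in (V2) cannot be lowered: for every `C < 2` there is an
odd prime `p` and a subgroup-TPP triple of `GL_2(𝔽_p)` carrying a level-ONE identity design (the design clause of the crux verbatim at
`(m,k) = (2,1)`) with

  `C · dim F_1|_{GL_2(𝔽_p)} < |H₁| |H₂| |H₃|`                                    (`exists_design_volume_gt_mul_finrank`).

The triple is the tree's FAMILY A (`FamilyA.familyA_levelOne_design`: orders `p − 1, 2, p(p − 1)`, volume `V = 2p(p−1)²`, design
for every odd `p`), and the dimension bound is the tree's `LevelOneDim.finrank_levelOne_le_real` at `m = 2`: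
`dim F_1 ≤ 1 + p² + (p − 2)(p + 1)² = p³ + p² − 3p − 1`, so `V / dim F_1 ≥ 2p(p−1)²/(p³+p²−3p−1) → 2`; concretely
`C (p³+p²−3p−1) < 2p(p−1)²` as soon as `(2 − C) p ≥ 8` (and `p ≥ 3`), and primes that large exist (`Nat.exists_infinite_primes`).
So the design-volume ratio `sup V / D_k` over design-carrying subgroup-TPP triples is `≥ 2`; every complete census to date has
`V < 2 D_k` pointwise (ORACLE-g12 §G12-4b), which is what (V2) conjectures.
-/

set_option linter.dupNamespace false

noncomputable section

open scoped BigOperators Classical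
open Module Literature.RepresentationTheory.FiniteGroups
open Literature.Barriers.MatrixMultiplication (SubgroupTPP)

namespace Summit.MatrixMultiplication.MatrixMultiplication.Theorems.SubgroupIdentityDesigns.Negative
namespace VolumeRatioSharp

open Summit.MatrixMultiplication.MatrixMultiplication.Theorems.LieRankDesigns.Negative
open Summit.MatrixMultiplication.MatrixMultiplication.Theorems.LevelOneGL2Designs.Negative

/-- `dim F_1|_{GL_2(𝔽_p)} ≤ p³ + p² − 3p − 1` (the tree's level-one dimension bound at `m = 2`, denominators cleared).
[folklore] -/
theorem finrank_levelOne_two_le (p : ℕ) [hp : Fact p.Prime] :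
    (finrank ℂ (levelSubmodule p 2 1) : ℝ) ≤ (p : ℝ) ^ 3 + (p : ℝ) ^ 2 - 3 * p - 1 := by
  have h := LevelOneDim.finrank_levelOne_le_real (p := p) (m := 2) (by norm_num)
  have hp1 : (1 : ℝ) < p := by exact_mod_cast hp.out.one_lt
  have hne : (p : ℝ) - 1 ≠ 0 := ne_of_gt (sub_pos.mpr hp1)
  have ha : ((p : ℝ) ^ 2 - p) / ((p : ℝ) - 1) = p := by
    rw [div_eq_iff hne]; ring
  have hb : ((p : ℝ) ^ 2 - 1) / ((p : ℝ) - 1) = p + 1 := by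
    rw [div_eq_iff hne]; ring
  rw [ha, hb] at h
  nlinarith [h]

/-- The polynomial inequality behind `V / dim F_1 → 2`: for `0 < C`, `(2 − C) p ≥ 8` and `p ≥ 3`,
`C (p³ + p² − 3p − 1) < 2p(p − 1)²`. [folklore] -/
theorem poly_ineq {C x : ℝ} (hC : 0 < C) (hx : 3 ≤ x) (h8 : 8 ≤ (2 - C) * x) :
    C * (x ^ 3 + x ^ 2 - 3 * x - 1) < 2 * x * (x - 1) ^ 2 := by
  have hx0 : 0 < x := by linarith
  have h2 : 8 * x ^ 2 ≤ (2 - C) * x ^ 3 := by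
    have := mul_le_mul_of_nonneg_right h8 (sq_nonneg x)
    nlinarith [this]
  nlinarith [h2, hC, hx, sq_nonneg x, mul_pos hC hx0]

/-- **The constant `2` of (V2) is optimal.**  For every `C < 2` there is a prime `p` and a subgroup-TPP triple of `GL_2(𝔽_p)`
carrying a level-one identity design (the design clause of `SubgroupIdentityDesigns` verbatim at `k = 1`) whose volume exceeds
`C · dim F_1|_{GL_2(𝔽_p)}` — Family A at a prime with `(2 − C) p ≥ 8`. [folklore] -/
theorem exists_design_volume_gt_mul_finrank {C : ℝ} (hC : C < 2) :
    ∃ (p : ℕ) (_ : Fact p.Prime) (H₁ H₂ H₃ : Subgroup (GLm p 2)),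
      SubgroupTPP H₁ H₂ H₃ ∧
      (∃ c : Mat p 2 → ℂ, (∀ M, 1 < M.rank → c M = 0) ∧
        (∑ M, c M * ZMod.stdAddChar (Matrix.trace (M * ((1 : GLm p 2) : Mat p 2)))) = 1 ∧
        ∀ a ∈ H₁, ∀ b ∈ H₂, ∀ g ∈ H₃, a * b * g ≠ 1 →
          (∑ M, c M * ZMod.stdAddChar (Matrix.trace (M * ((a * b * g : GLm p 2) : Mat p 2)))) = 0) ∧
      C * (finrank ℂ (levelSubmodule p 2 1) : ℝ) < ((Nat.card H₁ * Nat.card H₂ * Nat.card H₃ : ℕ) : ℝ) := by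
  -- a prime `p ≥ max 3 ⌈8/(2−C)⌉`
  obtain ⟨p, hNp, hprime⟩ := Nat.exists_infinite_primes (max 3 (⌈8 / (2 - C)⌉₊))
  haveI : Fact p.Prime := ⟨hprime⟩
  have hp3 : 3 ≤ p := le_trans (le_max_left _ _) hNp
  have hp2 : p ≠ 2 := by omega
  have hceil : ⌈8 / (2 - C)⌉₊ ≤ p := le_trans (le_max_right _ _) hNp
  have hpos : 0 < 2 - C := by linarith
  have h8 : 8 ≤ (2 - C) * (p : ℝ) := by
    have h1 : 8 / (2 - C) ≤ (p : ℝ) := le_trans (Nat.le_ceil _) (by exact_mod_cast hceil)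
    have := mul_le_mul_of_nonneg_left h1 hpos.le
    rwa [mul_div_cancel₀ _ hpos.ne'] at this
  have hp3R : (3 : ℝ) ≤ p := by exact_mod_cast hp3
  obtain ⟨H₁, H₂, H₃, htpp, h1, h2, h3, -, -, hdes⟩ := FamilyA.familyA_levelOne_design p hp2
  refine ⟨p, inferInstance, H₁, H₂, H₃, htpp, hdes, ?_⟩
  -- `V = 2p(p−1)²`
  have hV : ((Nat.card H₁ * Nat.card H₂ * Nat.card H₃ : ℕ) : ℝ) = 2 * p * ((p : ℝ) - 1) ^ 2 := by
    rw [h1, h2, h3]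
    have hp1 : 1 ≤ p := by omega
    push_cast [Nat.cast_sub hp1]
    ring
  rw [hV]
  have hD := finrank_levelOne_two_le p
  have hD0 : (0 : ℝ) ≤ (finrank ℂ (levelSubmodule p 2 1) : ℝ) := by positivity
  rcases le_or_gt C 0 with hC0 | hC0
  · -- `C ≤ 0`: `C · D ≤ 0 < V`
    have hVpos : (0 : ℝ) < 2 * p * ((p : ℝ) - 1) ^ 2 := by
      have : (0 : ℝ) < (p : ℝ) - 1 := by linarith
      positivity
    nlinarith [mul_nonpos_of_nonpos_of_nonneg hC0 hD0]
  · calc C * (finrank ℂ (levelSubmodule p 2 1) : ℝ) ≤ C * ((p : ℝ) ^ 3 + (p : ℝ) ^ 2 - 3 * p - 1) :=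
          mul_le_mul_of_nonneg_left hD hC0.le
      _ < 2 * p * ((p : ℝ) - 1) ^ 2 := poly_ineq hC0 hp3R h8

end VolumeRatioSharp
end Summit.MatrixMultiplication.MatrixMultiplication.Theorems.SubgroupIdentityDesigns.Negative

end
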